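import Summits.ABC.ABC.Theses.CubicResolventAllowance
import Literature.NumberTheory.EllipticCurves.PastenHeightBoundsLemma68LocalProofs
import Literature.NumberTheory.EllipticCurves.RationalIsogenyDegrees
import Literature.NumberTheory.DiophantineGeometry.MinimalDiscriminantFactorizationProofs
import HarnessLib

/-!
# STUB-IDEAS `stub_realCubic` · ideator k3 · generation 9 — THE ISOGENY AXIS (extremal configuration) + the k3 regime map

Crux stmt-ABC-22740 `CubicResolventAllowance.IndexSzpiro`, stub `stub_realCubic` (the `d_K > 0` half),
route-ABC-CubicResolventAllowance (draft).  HOME FAMILY 3 (probe the extremes).  Gens 0–8 of this slot probed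
the towers (`n₂`, odd towers, prime-power conductor, `M_p`, fixed `S`, the `(2,3,n)` Frey family, the cyclic
corner `d_K = 49`, the allowance `|d_K| ∣ 216N`); the one axis of the class nobody walked is the ISOGENY axis.

On the stub's class (no rational 2-torsion) every `ℚ`-rational cyclic isogeny has ODD degree (an even cyclic
kernel contains a Galois-stable subgroup of order 2, i.e. a rational 2-torsion point), so along the isogeny
graph `E[2]` is carried isomorphically (I1: an odd kernel meets `E[2]` trivially): the class, the cubic field
`K`, `d_K`, its sign and (literature, I4) the conductor `N` are CONSTANT on an isogeny class, while the
multiplicative towers DILATE, `n_p ↦ ℓ·n_p` or `n_p/ℓ` per prime-degree step (tree, PROVED: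
`WeierstrassCurve.ordMinimalDiscriminant_eq_mul_or_of_degree_eq_prime`; I2 is its two-sided bound).  Hence the
stub's right-hand side is an isogeny-class invariant and its left-hand side is maximised at the `Δ_min`-maximal
vertex: `StubRealCubic ⟸ StubRealCubic on Δ-maximal vertices` (I6, PROVED from the named inputs I3–I5), and a
minimal violator may be taken Δ-maximal in its isogeny class AND twist-minimal (k3 g3 / cC-3 N1).  The dilation
factor is bounded (`ℓ ∈ kenkuDegrees`, odd part `≤ 163`; tree `mazurKenku_exists_cyclic_isogeny`), so the
isogeny axis neither proves nor refutes the stub — it is the violator's NORMAL FORM and the natural generator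
of deep-tower census candidates (kit j344991: `ι` over the odd genus-0 families `X₀(3,5,7,9,13,25)`).
Sorries: I1 none (proved), I2 none, I5/I6 none; I3 is a named TARGET (`def`, L-sized), I4 a named literature
fact (`def`).  Nothing here implies the stub (verdict of gens 1–8, open-problem, stands).
-/

noncomputable section

open scoped NumberField
open NumberField IsDedekindDomain Polynomial WeierstrassCurve

namespace Summit.ABC.ABC.Cruxes.IndexSzpiro.StubIdeas3G9

open Summit.ABC.ABC.Theses.CubicResolventAllowance
open Literature.NumberTheory.EllipticCurves Literature.NumberTheory.EllipticCurves.ModularForms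

-- `Summit.ABC.ABC` is the mandated namespace (single-conjunct summit); the duplicate is deliberate.
set_option linter.dupNamespace false

/-- The registered stub `stub_realCubic`, verbatim. -/
def StubRealCubic : Prop :=
  ∀ ε : ℝ, 0 < ε → ∃ C : ℝ, ∀ (W : WeierstrassCurve ℚ) [W.IsElliptic] (K : Type) [Field K] [NumberField K],
    Irreducible W.twoTorsionPolynomial.toPoly → Module.finrank ℚ K = 3 →
    (∃ θ : K, aeval θ W.twoTorsionPolynomial.toPoly = 0) → 0 < NumberField.discr K →
    (W.minimalDiscriminantNorm ℤ : ℝ) ≤ C * |(NumberField.discr K : ℝ)| * (W.conductorNorm ℤ : ℝ) ^ (6 + ε)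

/-! ## I1 (S, PROVED) — an odd isogeny kernel contains no point of order 2 -/

/-- **I1.** If `deg φ = #ker φ` is odd, a kernel point killed by `2` is `O`.  (Lagrange: the order of
`P` in the finite group `ker φ` divides `#ker φ` and divides `2`.)  This is the group-theoretic core of
«odd isogenies carry `E[2]` isomorphically», i.e. of the class invariance I3. [folklore] -/
theorem eq_zero_of_mem_ker_of_two_nsmul {W W' : WeierstrassCurve ℚ} (φ : Isogeny W W')
    (hodd : Odd φ.degree) {P : W.geomPoints} (hP : P ∈ φ.toAddMonoidHom.ker) (h2 : (2 : ℕ) • P = 0) :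
    P = 0 := by
  set Q : φ.toAddMonoidHom.ker := ⟨P, hP⟩ with hQ
  have hdvd : addOrderOf Q ∣ φ.degree := addOrderOf_dvd_natCard Q
  have h2Q : (2 : ℕ) • Q = 0 := by
    apply Subtype.ext
    simpa [hQ] using h2
  have h2' : addOrderOf Q ∣ 2 := addOrderOf_dvd_of_nsmul_eq_zero h2Q
  have hg : Nat.gcd 2 φ.degree = 1 := Nat.Coprime.gcd_eq_one (Nat.coprime_two_left.mpr hodd)
  have h1 : addOrderOf Q = 1 := by
    have h := Nat.dvd_gcd h2' hdvd
    rw [hg] at h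
    exact Nat.dvd_one.mp h
  have hQ0 : Q = 0 := AddMonoid.addOrderOf_eq_one_iff.mp h1
  have := congrArg Subtype.val hQ0
  simpa [hQ] using this

/-! ## I2 (S, PROVED) — two-sided tower dilation along a prime-degree isogeny (the tree lemma, as a bound) -/

/-- **I2.** Along a `ℚ`-isogeny of prime degree `ℓ`, at a common multiplicative place the towers satisfy
`n_v(W') ≤ ℓ·n_v(W)` and `n_v(W) ≤ ℓ·n_v(W')` — from the tree's exact dichotomy
`n_v(W) = ℓ n_v(W') ∨ n_v(W') = ℓ n_v(W)` (Tate parameter `q ↦ q^ℓ` or `q ↦ q^{1/ℓ}`).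
[cite: SilvermanAEC2009, Prop. VII.5.1(b)] -/
theorem ordMinimalDiscriminant_le_mul_of_degree_eq_prime {W W' : WeierstrassCurve ℚ}
    [W.IsElliptic] [W'.IsElliptic] (φ : Isogeny W W') {ℓ : ℕ} (hℓ : ℓ.Prime) (hdeg : φ.degree = ℓ)
    (v : HeightOneSpectrum ℤ) (hv : W.HasMultiplicativeReductionAt v)
    (hv' : W'.HasMultiplicativeReductionAt v) :
    W'.ordMinimalDiscriminant v ≤ ℓ * W.ordMinimalDiscriminant v ∧
      W.ordMinimalDiscriminant v ≤ ℓ * W'.ordMinimalDiscriminant v := by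
  rcases ordMinimalDiscriminant_eq_mul_or_of_degree_eq_prime φ hℓ hdeg v hv hv' with h | h
  · refine ⟨?_, h.le⟩
    calc W'.ordMinimalDiscriminant v ≤ ℓ * W'.ordMinimalDiscriminant v :=
          Nat.le_mul_of_pos_left _ hℓ.pos
      _ = W.ordMinimalDiscriminant v := h.symm
      _ ≤ ℓ * W.ordMinimalDiscriminant v := Nat.le_mul_of_pos_left _ hℓ.pos
  · refine ⟨h.le, ?_⟩
    calc W.ordMinimalDiscriminant v ≤ ℓ * W.ordMinimalDiscriminant v :=
          Nat.le_mul_of_pos_left _ hℓ.pos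
      _ = W'.ordMinimalDiscriminant v := h.symm
      _ ≤ ℓ * W'.ordMinimalDiscriminant v := Nat.le_mul_of_pos_left _ hℓ.pos

/-! ## I3 (named TARGET, L) — the class data are isogeny-class invariants -/

/-- **I3 (target, L-sized; NOT to be staffed before the crux has a mechanism).**  If `W → W₀` is a
`ℚ`-isogeny and `ψ₂(W)` is irreducible, then `ψ₂(W₀)` is irreducible and has a root in the SAME cubic
field `K`.  Route: factor the isogeny as `[m] ∘ (cyclic)`; an even cyclic kernel would contain a rational
2-torsion point (excluded by irreducibility, tree
`not_hasIrreducibleModPGaloisRep_two_iff_exists_isRoot_twoTorsionPolynomial`); an odd one meets `E[2]`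
trivially (I1), so `E[2] ≅ E₀[2]` as Galois modules; `K = ℚ(P)` for a 2-torsion point `P` and
`x(φ P) ∈ ℚ(P)`. [cite: SilvermanAEC2009, Cor. III.4.11 and III.4.8] -/
def IsogenyClassInvariant : Prop :=
  ∀ (W W₀ : WeierstrassCurve ℚ) [W.IsElliptic] [W₀.IsElliptic], IsIsogenous W W₀ →
    Irreducible W.twoTorsionPolynomial.toPoly →
    ∀ (K : Type) [Field K] [NumberField K], (∃ θ : K, aeval θ W.twoTorsionPolynomial.toPoly = 0) →
      Irreducible W₀.twoTorsionPolynomial.toPoly ∧ ∃ θ₀ : K, aeval θ₀ W₀.twoTorsionPolynomial.toPoly = 0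

/-! ## I4 (named literature FACT, absent from the tree) — the conductor is an isogeny invariant -/

/-- **I4 (fact).** `ℚ`-isogenous elliptic curves have the same conductor (the conductor is read off the
`ℓ`-adic representation `V_ℓ E`, an isogeny invariant).  Not in the tree (only the model-change invariance
`conductorNorm_smul_rat` is); to be typed as a Literature named fact if ever needed, used here as a hypothesis.
[cite: SilvermanATAEC1994, IV.10–11] [cite: Knapp1992, Thm. 11.67 context] -/
def ConductorIsogenyInvariant : Prop :=
  ∀ (W W₀ : WeierstrassCurve ℚ) [W.IsElliptic] [W₀.IsElliptic], IsIsogenous W W₀ →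
    W.conductorNorm ℤ = W₀.conductorNorm ℤ

/-! ## I5 (named input) — every isogeny class has a `Δ_min`-maximal vertex dominating the given curve -/

/-- **I5 (fact-shaped input, M given finiteness).**  Every elliptic `W/ℚ` is isogenous to some `W₀` with
`Δ_min(W) ≤ Δ_min(W₀)` and `Δ_min(W') ≤ Δ_min(W₀)` for every `W'` isogenous to `W₀` — immediate from
the finiteness of `ℚ`-isomorphism classes in an isogeny class (Mazur–Kenku: at most 8; tree fact
`mazurKenku_exists_cyclic_isogeny` gives the degrees) plus `Δ_min` being an isomorphism invariant. [folklore] -/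
def IsoMaxExists : Prop :=
  ∀ (W : WeierstrassCurve ℚ) [W.IsElliptic], ∃ (W₀ : WeierstrassCurve ℚ) (_ : W₀.IsElliptic),
    IsIsogenous W W₀ ∧ W.minimalDiscriminantNorm ℤ ≤ W₀.minimalDiscriminantNorm ℤ ∧
    ∀ (W' : WeierstrassCurve ℚ) [W'.IsElliptic], IsIsogenous W₀ W' →
      W'.minimalDiscriminantNorm ℤ ≤ W₀.minimalDiscriminantNorm ℤ

/-! ## I6 (S, PROVED) — WLOG the violator is `Δ_min`-maximal in its isogeny class -/

/-- The stub restricted to `Δ_min`-maximal vertices of isogeny classes (extra hypothesis: `W` dominates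
every curve isogenous to it). -/
def StubRealCubicIsoMax : Prop :=
  ∀ ε : ℝ, 0 < ε → ∃ C : ℝ, ∀ (W : WeierstrassCurve ℚ) [W.IsElliptic] (K : Type) [Field K] [NumberField K],
    Irreducible W.twoTorsionPolynomial.toPoly → Module.finrank ℚ K = 3 →
    (∃ θ : K, aeval θ W.twoTorsionPolynomial.toPoly = 0) → 0 < NumberField.discr K →
    (∀ (W' : WeierstrassCurve ℚ) [W'.IsElliptic], IsIsogenous W W' →
      W'.minimalDiscriminantNorm ℤ ≤ W.minimalDiscriminantNorm ℤ) →
    (W.minimalDiscriminantNorm ℤ : ℝ) ≤ C * |(NumberField.discr K : ℝ)| * (W.conductorNorm ℤ : ℝ) ^ (6 + ε)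

/-- **I6 (extremal configuration, PROVED).**  Given class invariance (I3), conductor invariance (I4) and
Δ-maximal vertices (I5), the stub follows from its restriction to Δ-maximal vertices: the right-hand side
`C·|d_K|·N^{6+ε}` is constant on the isogeny class and the left-hand side is largest at the top. -/
theorem stubRealCubic_of_isoMax (hcl : IsogenyClassInvariant) (hN : ConductorIsogenyInvariant)
    (hex : IsoMaxExists) (h : StubRealCubicIsoMax) : StubRealCubic := by
  intro ε hε
  obtain ⟨C, hC⟩ := h ε hε
  refine ⟨C, ?_⟩
  intro W _ K _ _ hirr hK hroot hdK
  obtain ⟨W₀, _, hiso, hdom, hmax⟩ := hex W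
  obtain ⟨hirr₀, hroot₀⟩ := hcl W W₀ hiso hirr K hroot
  have h₀ := hC W₀ K hirr₀ hK hroot₀ hdK (fun W' _ hW' => hmax W' hW')
  have hNeq : W.conductorNorm ℤ = W₀.conductorNorm ℤ := hN W W₀ hiso
  have hdom' : (W.minimalDiscriminantNorm ℤ : ℝ) ≤ (W₀.minimalDiscriminantNorm ℤ : ℝ) := by
    exact_mod_cast hdom
  rw [hNeq]
  exact hdom'.trans h₀

/-! ## I7 (S, PROVED) — the quantitative face: one prime-degree step changes `log Δ_min` by a factor `≤ ℓ`
on the multiplicative part; with `ℓ ≤ 163` (Kenku) the Szpiro ratio varies by a bounded factor on a class. -/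

/-- **I7.** Kenku's list is bounded by `163` (tree), so the per-step dilation factor of I2 is `≤ 163`. -/
theorem dilation_factor_le_163 {n : ℕ} (h : n ∈ kenkuDegrees) : n ≤ 163 :=
  le_of_mem_kenkuDegrees h

end Summit.ABC.ABC.Cruxes.IndexSzpiro.StubIdeas3G9

end
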